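import Summits.CriticalPhenomena.SAWScalingLimit.Theorems.SAWDevelopingMapInteriorFlatteningLiouvilleDefs
import Summits.CriticalPhenomena.SAWScalingLimit.Theorems.SAWDevelopingMapInteriorFlatteningFactorisation
import Summits.CriticalPhenomena.SAWScalingLimit.Theorems.SAWDevelopingMapInteriorFlatteningOneScaleGlue

/-!
# Last-exit factorisation at one scale (stub `stub_lastExitFactorisation`, line `liouville-local-limits`)

Crux `stmt-CriticalPhenomena-8297` (`…Theses.SAWDevelopingMap.InteriorFlattening`), line
`liouville-local-limits`, registered stub `stub_lastExitFactorisation` (statement S4 of the lead's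
skeleton), over the objects `obs`, `latticeBall`, `Pic`, `amp`, `picDom`, `picRoot` of
`…Theorems.SAWDevelopingMapInteriorFlatteningLiouvilleDefs`: for a root mid-edge `ρ` with both
endpoints outside the lattice ball `B_S(O)` and `p, q ∈ D ∩ B_S(O)`,
`F_{D,ρ}({p,q}) = Σ_{P ∈ Pic S} amp(P) · F_{picDom P, picRoot P}({p,q})`.

**Proof (re-indexing of the landed one-mouth factorisation).** Apply
`OneMouth.stub_factorisation` (file `…InteriorFlatteningFactorisation`) with `Λ := D`,
`S' := D ∩ B_S(O)`, root `ρ` (endpoints off `S'`), `x := p`, `y := q`: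
`F_{D,ρ}({p,q}) = Σ_{c ∈ Conf D S'} amp_{S'}(c) · F_{c.1, root c}({p,q})`. Re-index
`Conf D S' → Pic S` by `c = (D', (u,u')) ↦ (S' ∖ D', (u,u'))`: it lands in `Pic S` (the dart tail
is within `S + 1` of `c_O` by the triangle inequality, `dist_le_one_of_adj`), is injective
(`D' = S' ∖ (S' ∖ D')`), the summands agree (`picDom = D'`, and for a walk `ψ ⊆ D` one has
`ψ ∩ B_S = S' ∖ D' ↔ S' ∖ ψ = D'`), and every picture outside the image contributes `0` (no walk
of `D` realises it, or the inner root has no endpoint in the picture domain,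
`Fobs_eq_zero_of_not_mem`). Assembled with `Finset.sum_image` + `Finset.sum_subset`. Pure finite
combinatorics; axioms `propext, Classical.choice, Quot.sound`.
-/

noncomputable section

open scoped BigOperators
open Literature.Probability.LatticeModels Literature.Probability.RandomPlanarGeometry.SAW

namespace Summit.CriticalPhenomena.SAWScalingLimit.Theorems.InteriorFlattening.Liouville

namespace LastExit

/-- `obs` (this line) and `OneMouth.Fobs` (the sibling line) are the same observable. -/
theorem obs_eq_Fobs (Λ : Finset HexVertex) (a z : Sym2 HexVertex) :
    obs Λ a z = OneMouth.Fobs Λ a z := rfl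

/-- An entrance dart `(u, u')` of `S' = D ∩ B_S(O)` inside `D` is an entrance dart of the ball:
`u ∈ B_{S+1}(O) ∖ B_S(O)` (triangle inequality, `dist_le_one_of_adj`), `u' ∈ B_S(O)`, `u ∼ u'`. -/
theorem mem_darts_of_mem_entr {D : Finset HexVertex} {S : ℝ} {d : HexVertex × HexVertex}
    (hd : d ∈ OneMouth.entr D (D ∩ latticeBall S)) : d ∈ darts S := by
  simp only [OneMouth.entr, Finset.mem_filter, Finset.mem_product, Finset.mem_inter] at hd
  obtain ⟨⟨huD, -, hu'B⟩, huS', hadj⟩ := hd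
  have huB : d.1 ∉ latticeBall S := fun h => huS' ⟨huD, h⟩
  simp only [darts, Finset.mem_filter, Finset.mem_product, Finset.mem_sdiff]
  refine ⟨⟨⟨?_, huB⟩, hu'B⟩, hadj⟩
  rw [mem_latticeBall_iff] at hu'B ⊢
  calc dist (hexCenter d.1) (hexCenter O)
        ≤ dist (hexCenter d.1) (hexCenter d.2) + dist (hexCenter d.2) (hexCenter O) :=
        dist_triangle _ _ _
    _ ≤ 1 + S := add_le_add (by rw [dist_comm]; exact OneMouth.dist_le_one_of_adj hadj) hu'B
    _ = S + 1 := add_comm _ _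

/-- The re-indexed configuration `(S' ∖ D', (u, u'))` of `c = (D', (u, u')) ∈ Conf D S'`,
`S' = D ∩ B_S(O)`, is a picture of `Pic S`. -/
theorem toPic_mem_Pic {D : Finset HexVertex} {S : ℝ} {c : OneMouth.Config}
    (hc : c ∈ OneMouth.Conf D (D ∩ latticeBall S)) :
    ((D ∩ latticeBall S) \ c.1, c.2) ∈ Pic S := by
  simp only [OneMouth.Conf, Finset.mem_product, Finset.mem_powerset] at hc
  simp only [Pic, Finset.mem_product, Finset.mem_powerset]
  exact ⟨Finset.sdiff_subset.trans Finset.inter_subset_right, mem_darts_of_mem_entr hc.2⟩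

/-- The re-indexing `c = (D', (u, u')) ↦ (S' ∖ D', (u, u'))` is injective on `Conf D S'`
(`D' ⊆ S'`, so `D' = S' ∖ (S' ∖ D')`). -/
theorem toPic_injOn (D S' : Finset HexVertex) :
    Set.InjOn (fun c : OneMouth.Config => (S' \ c.1, c.2)) ↑(OneMouth.Conf D S') := by
  intro c₁ h₁ c₂ h₂ h
  simp only [Finset.mem_coe, OneMouth.Conf, Finset.mem_product, Finset.mem_powerset] at h₁ h₂
  simp only [Prod.mk.injEq] at h
  obtain ⟨h1, h2⟩ := h
  refine Prod.ext ?_ h2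
  calc c₁.1 = S' \ (S' \ c₁.1) := (Finset.sdiff_sdiff_eq_self h₁.1).symm
    _ = S' \ (S' \ c₂.1) := by rw [h1]
    _ = c₂.1 := Finset.sdiff_sdiff_eq_self h₂.1

/-- The two intrusion conditions agree walk by walk: for a vertex set `V ⊆ D`, `S' = D ∩ B`
and `D' ⊆ S'`, `V ∩ B = S' ∖ D' ↔ S' ∖ V = D'`. -/
theorem inter_eq_sdiff_iff {D V B S' D' : Finset HexVertex} (hV : V ⊆ D) (hS' : S' = D ∩ B)
    (hD' : D' ⊆ S') : V ∩ B = S' \ D' ↔ S' \ V = D' := by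
  have hVB : V ∩ B = S' ∩ V := by
    ext x
    simp only [Finset.mem_inter, hS']
    exact ⟨fun h => ⟨⟨hV h.1, h.2⟩, h.1⟩, fun h => ⟨h.2, h.1.2⟩⟩
  rw [hVB]
  constructor
  · intro h
    rw [← Finset.sdiff_sdiff_eq_self hD', ← h, Finset.sdiff_inter_self_left]
  · intro h
    rw [← h, Finset.sdiff_sdiff_self_left]

/-- On a configuration `c = (D', (u, u'))` of `S' = D ∩ B_S(O)` the two summands agree:
`picDom = D'`, `picRoot = root`, `obs = Fobs`, and the prefix amplitudes coincide termwise
(`inter_eq_sdiff_iff` on the vertex set of each prefix `ψ ⊆ D`). -/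
theorem summand_eq {D S' D' : Finset HexVertex} {ρ z : Sym2 HexVertex} {S : ℝ} {u u' : HexVertex}
    (hS' : S' = D ∩ latticeBall S) (hD' : D' ⊆ S') :
    amp D ρ S (S' \ D', (u, u')) *
        obs (picDom D S (S' \ D', (u, u'))) (picRoot (S' \ D', (u, u'))) z =
      OneMouth.amp D ρ S' (D', (u, u')) * OneMouth.Fobs D' s(u, u') z := by
  have hdom : picDom D S (S' \ D', (u, u')) = D' := by
    show (D ∩ latticeBall S) \ (S' \ D') = D'
    rw [← hS']
    exact Finset.sdiff_sdiff_eq_self hD'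
  have hroot : picRoot (S' \ D', (u, u')) = s(u, u') := rfl
  rw [hdom, hroot, obs_eq_Fobs]
  congr 1
  show (∑ ψ : HexMidEdgeSAW D ρ s(u, u'),
      if ψ.verts.getLast? = some u ∧ ψ.verts.toFinset ∩ latticeBall S = S' \ D'
      then ψ.weight xc (5 / 8) else 0) =
    ∑ ψ : HexMidEdgeSAW D ρ s(u, u'),
      if ψ.verts.getLast? = some u ∧ S' \ ψ.verts.toFinset = D' then ψ.weight xc (5 / 8) else 0
  refine Finset.sum_congr rfl fun ψ _ => if_congr ?_ rfl rfl
  have hV : ψ.verts.toFinset ⊆ D := fun v hv => ψ.subset v (List.mem_toFinset.1 hv)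
  exact and_congr_right fun _ => inter_eq_sdiff_iff hV hS' hD'

/-- If no prefix of `D` from `ρ` can realise the picture `P` — its dart tail is not in `D`, or its
intrusion set is not inside `D ∩ B_S(O)` — the prefix amplitude vanishes. -/
theorem amp_eq_zero {D : Finset HexVertex} {ρ : Sym2 HexVertex} {S : ℝ} {P : Picture}
    (h : P.2.1 ∉ D ∨ ¬ P.1 ⊆ D ∩ latticeBall S) : amp D ρ S P = 0 := by
  unfold amp
  refine Finset.sum_eq_zero fun ψ _ => if_neg fun hψ => ?_
  rcases h with hy | hI
  · exact hy (ψ.subset _ (List.mem_of_getLast? hψ.1))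
  · refine hI ?_
    rw [← hψ.2]
    intro v hv
    rw [Finset.mem_inter] at hv ⊢
    exact ⟨ψ.subset v (List.mem_toFinset.1 hv.1), hv.2⟩

/-- Every picture of `Pic S` outside the image of the re-indexing contributes `0`: either no
prefix realises it (`amp_eq_zero`), or the dart head is not in `D`, in which case the root of
the picture domain has no endpoint in it and the inner observable vanishes
(`OneMouth.Fobs_eq_zero_of_not_mem`); otherwise it IS the image of `(S' ∖ P.1, P.2)`. -/
theorem summand_eq_zero {D S' : Finset HexVertex} {ρ z : Sym2 HexVertex} {S : ℝ}
    (hS' : S' = D ∩ latticeBall S) {P : Picture} (hP : P ∈ Pic S)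
    (hnot : P ∉ (OneMouth.Conf D S').image fun c => (S' \ c.1, c.2)) :
    amp D ρ S P * obs (picDom D S P) (picRoot P) z = 0 := by
  obtain ⟨I, y, w⟩ := P
  simp only [Pic, darts, Finset.mem_product, Finset.mem_powerset, Finset.mem_filter,
    Finset.mem_sdiff] at hP
  obtain ⟨-, ⟨⟨-, hyB⟩, hwB⟩, hadj⟩ := hP
  by_cases hy : y ∈ D
  · by_cases hI : I ⊆ D ∩ latticeBall S
    · by_cases hw : w ∈ D
      · exfalso
        refine hnot (Finset.mem_image.2 ⟨(S' \ I, (y, w)), ?_, ?_⟩)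
        · simp only [OneMouth.Conf, OneMouth.entr, Finset.mem_product, Finset.mem_powerset,
            Finset.mem_filter]
          refine ⟨Finset.sdiff_subset, ⟨hy, ?_⟩, ?_, hadj⟩
          · rw [hS']
            exact Finset.mem_inter.2 ⟨hw, hwB⟩
          · rw [hS']
            exact fun h => hyB (Finset.mem_inter.1 h).2
        · subst hS'
          show ((D ∩ latticeBall S) \ ((D ∩ latticeBall S) \ I), (y, w)) = (I, (y, w))
          rw [Finset.sdiff_sdiff_eq_self hI]
      · have hy' : y ∉ picDom D S (I, y, w) := fun h =>
          hyB (Finset.mem_inter.1 (Finset.mem_sdiff.1 h).1).2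
        have hw' : w ∉ picDom D S (I, y, w) := fun h =>
          hw (Finset.mem_inter.1 (Finset.mem_sdiff.1 h).1).1
        rw [obs_eq_Fobs, show picRoot (I, y, w) = s(y, w) from rfl,
          OneMouth.Fobs_eq_zero_of_not_mem hy' hw', mul_zero]
    · rw [amp_eq_zero (Or.inr hI), zero_mul]
  · rw [amp_eq_zero (Or.inl hy), zero_mul]

end LastExit

open LastExit

/-- **S4 — exact last-exit factorisation at one scale.** For a root mid-edge `ρ` with both
endpoints outside `B_S(O)` and target endpoints `p, q ∈ D ∩ B_S(O)`,
`F_{D,ρ}({p,q}) = Σ_{P ∈ Pic S} amp(P) · F_{picDom P, picRoot P}({p,q})`: every walk is cut at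
its LAST vertex outside the ball. Proof: the one-mouth factorisation `OneMouth.stub_factorisation`
with `S' = D ∩ B_S(O)`, re-indexed from `Conf D S'` to `Pic S` by `(D', dart) ↦ (S' ∖ D', dart)`
(`summand_eq`, `toPic_injOn`, `toPic_mem_Pic`, `summand_eq_zero`). -/
theorem stub_lastExitFactorisation :
    ∀ (D : Finset HexVertex) (ρ : Sym2 HexVertex) (S : ℝ) (p q : HexVertex),
      (∀ u ∈ ρ, u ∉ latticeBall S) → p ∈ latticeBall S → q ∈ latticeBall S → p ∈ D → q ∈ D →
        obs D ρ s(p, q) = ∑ P ∈ Pic S, amp D ρ S P * obs (picDom D S P) (picRoot P) s(p, q) := by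
  intro D ρ S p q hρ hp hq hpD hqD
  set S' : Finset HexVertex := D ∩ latticeBall S with hS'
  have hS'D : S' ⊆ D := Finset.inter_subset_left
  have hρS' : ∀ t ∈ ρ, t ∉ S' := fun t ht htS' => hρ t ht (Finset.mem_inter.1 htS').2
  have hpS' : p ∈ S' := Finset.mem_inter.2 ⟨hpD, hp⟩
  have hqS' : q ∈ S' := Finset.mem_inter.2 ⟨hqD, hq⟩
  rw [obs_eq_Fobs, OneMouth.stub_factorisation D S' ρ p q hS'D hρS' hpS' hqS']
  have himg : (OneMouth.Conf D S').image (fun c => (S' \ c.1, c.2)) ⊆ Pic S := by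
    intro P hP
    obtain ⟨c, hc, rfl⟩ := Finset.mem_image.1 hP
    exact toPic_mem_Pic hc
  rw [← Finset.sum_subset himg fun P hP hnot => summand_eq_zero hS' hP hnot,
    Finset.sum_image (toPic_injOn D S')]
  refine Finset.sum_congr rfl fun c hc => ?_
  obtain ⟨D', u, u'⟩ := c
  simp only [OneMouth.Conf, Finset.mem_product, Finset.mem_powerset] at hc
  exact (summand_eq hS' hc.1).symm

end Summit.CriticalPhenomena.SAWScalingLimit.Theorems.InteriorFlattening.Liouville

end
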